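import Literature.AlgebraicGeometry.Motives.HodgeLieWeightOnePlusLineSimple
import Literature.AlgebraicGeometry.Motives.HodgeThetaSubalgebraSymplecticRankTen
import Literature.AlgebraicGeometry.Motives.HodgeLieRigidModuloCentre
import HarnessLib

/-!
# Weight one, `End_Hdg = ℚ`: the Hodge Lie algebra is `ℚ`-SIMPLE (Deligne, LNM 900 I 3.4–3.6; Moonen–Zarhin 1999 (3.1))

Family `hodge`, layer `Literature/AlgebraicGeometry/Motives`; THEOREMS ONLY (no definition, no named fact; D-0026).
Written for the cell `pub-hodgeav-hg6` (LADDER-HodgeAV row 2, «base of the HC ladder», dimension-6 TABLE X, fact-bound row 1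
`g6.I(1)` and row 8-`(4,2)`; honest framing of that cell: HC / HC_AV / HC_CM NOT proved, HC_CM only a displayed binder).
This file itself is unconditional linear algebra of polarizable Hodge structures, the GENERAL form of the tree's
`isSimple_hodgeLie_of_plusLine_of_forall_endAlg_eq_smul` (`HodgeLieWeightOnePlusLineSimple`, plus-line position only).

SETTING.  `H` a polarized `ℚ`-Hodge structure of weight `1`, effective, on a finite-dimensional `V ≠ 0`; `𝔥 = Lie Hg(H)`
(`hodgeLie`), `𝔥_ℂ = hodgeLieC`; `Θ` the Hodge operator (`+1` on `P = V^{1,0}`, `−1` on `Q = V^{0,1}`); an operator `B`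
of `V_ℂ` is RAISING if `B P = 0` and `B V_ℂ ⊆ P`.

RESULTS.
* §1 **`WeightOneSimple.raising_trivial_of_commute`** (the orthogonality lemma) — let `𝔄, 𝔅 ⊆ 𝔥_ℂ` be complex subspaces
  stable under `ad 𝔥_ℂ`, with `𝔅` stable under `Y ↦ conj ∘ Y ∘ conj` and `[𝔄, 𝔅] = 0`, and assume `End_Hdg(V) = ℚ`.  Then
  EITHER every raising element of `𝔄` is `0`, OR every raising element of `𝔅` is `0`.  PROOF: for raising `A ∈ 𝔄`, `B ∈ 𝔅`
  the conjugate `B̄ ∈ 𝔅` is lowering and commutes with `A`, so `A B̄` maps `V_ℂ` into `P ∩ Q = 0`; hence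
  `ψ_ℂ(A v, conj (B w)) = −ψ_ℂ(v, A B̄ (conj w)) = 0` — the images `S_𝔄 = Σ A V_ℂ` and `S_𝔅` are ORTHOGONAL in `P` for the
  Hodge–Riemann pairing `ψ_ℂ(x, conj y)`.  Both are stable under the Levi part of `𝔥_ℂ` (the operators preserving `P`:
  `Z(Av) = [Z, A]v + A(Zv)` with `[Z, A] ∈ 𝔄` raising), and `P` is irreducible under that Levi part (orbit lemma
  `SymplecticThetaSix.eq_bot_or_eq_of_stable_le` over the irreducibility of `V_ℂ` under `𝔥_ℂ`, which is `End_Hdg = ℚ` plus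
  polarization complements, `SymplecticTheta.eq_bot_or_top_of_stable`).  So `S_𝔄, S_𝔅 ∈ {0, P}`, and `S_𝔄 = S_𝔅 = P ≠ 0`
  contradicts the second Hodge–Riemann relation `i ψ_ℂ(p, conj p) > 0`.
* §2 **`WeightOneSimple.commute_theta_of_raising_trivial`** — a conjugation-stable, `ad Θ`-stable `𝔅 ⊆ End(V_ℂ)` without
  non-zero raising elements commutes with `Θ` (`Y = Y⁺ + Y⁻ + ½(Y + ΘYΘ)`, `Y⁻ = conj ∘ (·) ∘ conj` of a raising element).
* §3 **`isSimple_hodgeLie_of_forall_endAlg_eq_smul`** — for `H` effective polarized of weight `1` on `V ≠ 0` with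
  `End_Hdg(V) = ℚ`, EVERY Lie subalgebra `𝔏 ≤ 𝔤𝔩_ℚ(V)` with carrier `Lie Hg(H)` is a SIMPLE Lie algebra over `ℚ`
  (`LieAlgebra.IsSimple ℚ 𝔏`).  PROOF: `𝔷 = 𝔥 ∩ End_Hdg = 0` (`hodgeLie_inf_endAlg_eq_bot_of_forall_endAlg_eq_smul`) makes
  `𝔥 = [𝔥, 𝔥]` semisimple (`AnyWeight.isSemisimple_of_eq_hodgeLie_derived`); an ideal `I` has the complementary ideal `J = Iᶜ`
  with `[I, J] ⊆ I ∩ J = 0`; §1 applied to `𝔄 = I_ℂ`, `𝔅 = J_ℂ` (complex spans of rational subspaces are conjugation-stable)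
  leaves an ideal WITHOUT raising elements, which by §2 commutes with `Θ`; its rational elements are then Hodge endomorphisms
  (`mem_endAlg_of_commute_theta`) inside `𝔥 ∩ End_Hdg = 0` — so `J = 0`, `I = 𝔥` (or `I = 0`).  Non-abelian: `𝔥` abelian
  would give `𝔥 = [𝔥, 𝔥] = 0`, `Θ ∈ 𝔥_ℂ = 0`, `P = 0`, `V = 0`.  This is Deligne's remark (LNM 900 I 3.4–3.6 with Moonen–Zarhin
  (3.1)) that `μ` projects non-trivially to every `ℚ`-simple factor of `Hg`, together with the observation that for
  `End_Hdg = ℚ` it can project non-trivially to only ONE factor; it is the first step of «`End⁰ = ℚ` ⟹ `Hg = Sp_{2g}` for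
  `2g ∉` Tankeev's exceptional set» (Tankeev; Pink 1998 Thm. 5.14) beyond the tree's ranks `4, 6, 10`.

## References

* [Deligne1982HodgeCycles] P. Deligne, *Hodge cycles on abelian varieties*, LNM 900 (1982), I §3, Prop. 3.4, Prop. 3.6,
  Example 3.7.
* [MoonenZarhin1999LowDim] B. Moonen, Yu. Zarhin, *Hodge classes on abelian varieties of low dimension*, Math. Ann. 315
  (1999), §2 (2.3), §3 (3.1) (`Hg` is the smallest `ℚ`-subgroup containing `h(U¹)`).
* [Humphreys1972] J. E. Humphreys, GTM 9 (1972), §5.2 (ideals of a semisimple Lie algebra and their complements).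
* [Gordon1997] B. B. Gordon, *A survey of the Hodge conjecture for abelian varieties*, arXiv:alg-geom/9709030, §6 (proof of
  Thm. 6.3.3: the orbit of a highest weight line).
-/

noncomputable section

open scoped TensorProduct

namespace Literature.AlgebraicGeometry.Motives

universe u

namespace HodgeStructure

variable {V : Type u} [AddCommGroup V] [Module ℚ V] [Module.Finite ℚ V] [HodgeTensorFacts.{u, u}] {n : ℤ}

/-! ## §1 The orthogonality lemma: two commuting `ad 𝔥_ℂ`-stable subspaces cannot both raise -/

set_option maxHeartbeats 800000 in
/-- **Orthogonality lemma.**  `H` effective polarized of weight `1` with `End_Hdg(V) = ℚ`; `𝔄, 𝔅 ⊆ 𝔥_ℂ` stable under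
`ad 𝔥_ℂ`, `𝔅` stable under `Y ↦ conj ∘ Y ∘ conj`, `[𝔄, 𝔅] = 0`.  Then every raising element of `𝔄` vanishes, or every raising
element of `𝔅` vanishes: the images of the raising elements of `𝔄` and of `𝔅` are Levi-stable subspaces of `P = V^{1,0}`,
orthogonal for `ψ_ℂ(x, conj y)` (`A B̄ : V_ℂ → P ∩ Q = 0`), each `0` or `P` by the orbit lemma, not both `P` by the second
Hodge–Riemann relation. [cite: Deligne1982HodgeCycles, I §3 Prop. 3.4 and Prop. 3.6] [cite: Gordon1997, §6 (proof of Thm. 6.3.3)]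
[cite: MoonenZarhin1999LowDim, §3 (3.1)] -/
theorem WeightOneSimple.raising_trivial_of_commute (H : HodgeStructure V n) (ψ : H.Polarization) (hn : n = 1)
    (heff : H.IsEffective) (hE : ∀ a ∈ H.endAlg, ∃ x : ℚ, a = x • 1) {Θ : Module.End ℂ (ℂ ⊗[ℚ] V)}
    (hΘ : ∀ p, ∀ x ∈ H.piece p (n - p), Θ x = ((2 * p - n : ℤ) : ℂ) • x)
    {𝔄 𝔅 : Submodule ℂ (Module.End ℂ (ℂ ⊗[ℚ] V))} (h𝔄 : 𝔄 ≤ H.hodgeLieC) (h𝔅 : 𝔅 ≤ H.hodgeLieC)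
    (h𝔄ad : ∀ Z ∈ H.hodgeLieC, ∀ A ∈ 𝔄, Z * A - A * Z ∈ 𝔄) (h𝔅ad : ∀ Z ∈ H.hodgeLieC, ∀ B ∈ 𝔅, Z * B - B * Z ∈ 𝔅)
    (h𝔅conj : ∀ B ∈ 𝔅, ∀ C : Module.End ℂ (ℂ ⊗[ℚ] V), (∀ v, C v = conj (B (conj v))) → C ∈ 𝔅)
    (hcomm : ∀ A ∈ 𝔄, ∀ B ∈ 𝔅, A * B = B * A) :
    (∀ A ∈ 𝔄, (∀ p ∈ H.piece 1 0, A p = 0) → (∀ v, A v ∈ H.piece 1 0) → A = 0) ∨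
      (∀ B ∈ 𝔅, (∀ p ∈ H.piece 1 0, B p = 0) → (∀ v, B v ∈ H.piece 1 0) → B = 0) := by
  classical
  have hΘM : Θ ∈ H.hodgeLieC := H.mem_hodgeLieC_of_forall_piece hΘ
  have hΘ𝔤 : Θ ∈ spanC H.hodgeLie := (hodgeLieC_eq_spanC H) ▸ hΘM
  have hskew : ∀ X ∈ H.hodgeLie, ∀ v w, ψ.form (X v) w + ψ.form v (X w) = 0 :=
    fun X hX v w => form_apply_add_eq_zero_of_mem_hodgeLie ψ hX v w
  -- `V_ℂ` is irreducible under `𝔥_ℂ` (`End_Hdg = ℚ` and polarization complements)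
  have hirr : ∀ U : Submodule ℂ (ℂ ⊗[ℚ] V), (∀ Z ∈ H.hodgeLieC, ∀ u ∈ U, Z u ∈ U) → U = ⊥ ∨ U = ⊤ :=
    fun U hU => SymplecticTheta.eq_bot_or_top_of_stable H hn heff ψ hE H.hodgeLie hΘ hΘ𝔤 hskew
      fun X hX u hu => hU _ (H.baseChange_mem_hodgeLieC hX) u hu
  subst hn
  obtain ⟨hPmem, hQmem, hΘ10, hΘ01, hΘΘ⟩ := UnitaryTheta.theta_facts H rfl heff hΘ
  set P := H.piece 1 0 with hPdef
  set Q := H.piece 0 1 with hQdef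
  set ω := ψ.form.baseChange ℂ with hω
  have hbrC : ∀ Y ∈ H.hodgeLieC, ∀ Z ∈ H.hodgeLieC, Y * Z - Z * Y ∈ H.hodgeLieC :=
    fun Y hY Z hZ => H.commutator_mem_hodgeLieC hY hZ
  have hPQ0 : ∀ x, x ∈ P → x ∈ Q → x = 0 := fun x hP hQ => by
    have h1 := hΘ10 x hP
    rw [hΘ01 x hQ] at h1
    have h2 : (2 : ℂ) • x = 0 := by rw [two_smul]; nth_rewrite 1 [← h1]; rw [neg_add_cancel]
    exact (smul_eq_zero.1 h2).resolve_left (two_ne_zero' ℂ)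
  -- the image of the raising part of an `ad 𝔥_ℂ`-stable subspace is Levi-stable, hence `0` or `P`
  have himg : ∀ 𝔇 : Submodule ℂ (Module.End ℂ (ℂ ⊗[ℚ] V)), (∀ Z ∈ H.hodgeLieC, ∀ D ∈ 𝔇, Z * D - D * Z ∈ 𝔇) →
      Submodule.span ℂ {x : ℂ ⊗[ℚ] V | ∃ D ∈ 𝔇, (∀ p ∈ P, D p = 0) ∧ (∀ v, D v ∈ P) ∧ ∃ v, x = D v} = ⊥ ∨
      Submodule.span ℂ {x : ℂ ⊗[ℚ] V | ∃ D ∈ 𝔇, (∀ p ∈ P, D p = 0) ∧ (∀ v, D v ∈ P) ∧ ∃ v, x = D v} = P := by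
    intro 𝔇 h𝔇ad
    refine SymplecticThetaSix.eq_bot_or_eq_of_stable_le H.hodgeLieC hbrC hΘM hΘΘ hΘ10 hΘ01 hPmem hQmem hirr _
      (Submodule.span_le.2 ?_) fun Z hZ hZP u hu => ?_
    · rintro _ ⟨D, -, -, hDim, v, rfl⟩
      exact hDim v
    · induction hu using Submodule.span_induction with
      | mem x hx =>
        obtain ⟨D, hD, hDP, hDim, v, rfl⟩ := hx
        -- `Z (D v) = [Z, D] v + D (Z v)` with `[Z, D] ∈ 𝔇` raising
        have hbr := h𝔇ad Z hZ D hD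
        have h1 : Z (D v) = (Z * D - D * Z) v + D (Z v) := by
          rw [LinearMap.sub_apply, Module.End.mul_apply, Module.End.mul_apply, sub_add_cancel]
        rw [h1]
        refine Submodule.add_mem _ (Submodule.subset_span ⟨_, hbr, fun p hp => ?_, fun w => ?_, v, rfl⟩)
          (Submodule.subset_span ⟨D, hD, hDP, hDim, Z v, rfl⟩)
        · rw [LinearMap.sub_apply, Module.End.mul_apply, Module.End.mul_apply, hDP p hp, map_zero,
            hDP _ (hZP p hp), sub_zero]
        · rw [LinearMap.sub_apply, Module.End.mul_apply, Module.End.mul_apply]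
          exact Submodule.sub_mem _ (hZP _ (hDim w)) (hDim _)
      | zero => rw [map_zero]; exact Submodule.zero_mem _
      | add x y _ _ hx hy => rw [map_add]; exact Submodule.add_mem _ hx hy
      | smul c x _ hx => rw [map_smul]; exact Submodule.smul_mem _ c hx
  obtain ⟨S𝔄, hS𝔄⟩ : ∃ S : Submodule ℂ (ℂ ⊗[ℚ] V),
      S = Submodule.span ℂ {x : ℂ ⊗[ℚ] V | ∃ D ∈ 𝔄, (∀ p ∈ P, D p = 0) ∧ (∀ v, D v ∈ P) ∧ ∃ v, x = D v} := ⟨_, rfl⟩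
  obtain ⟨S𝔅, hS𝔅⟩ : ∃ S : Submodule ℂ (ℂ ⊗[ℚ] V),
      S = Submodule.span ℂ {x : ℂ ⊗[ℚ] V | ∃ D ∈ 𝔅, (∀ p ∈ P, D p = 0) ∧ (∀ v, D v ∈ P) ∧ ∃ v, x = D v} := ⟨_, rfl⟩
  have himgA := himg 𝔄 h𝔄ad
  have himgB := himg 𝔅 h𝔅ad
  rw [← hS𝔄] at himgA
  rw [← hS𝔅] at himgB
  -- orthogonality `ψ_ℂ(x, conj y) = 0` for `x ∈ S𝔄`, `y ∈ S𝔅`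
  have horth : ∀ x ∈ S𝔄, ∀ y ∈ S𝔅, ω x (conj y) = 0 := by
    -- generators first
    have hgen : ∀ A ∈ 𝔄, (∀ p ∈ P, A p = 0) → (∀ v, A v ∈ P) → ∀ B ∈ 𝔅, (∀ p ∈ P, B p = 0) → (∀ v, B v ∈ P) →
        ∀ v w, ω (A v) (conj (B w)) = 0 := by
      intro A hA hAP hAim B hB hBP hBim v w
      obtain ⟨C, hC⟩ := exists_conjOp B
      have hC𝔅 : C ∈ 𝔅 := h𝔅conj B hB C hC
      -- `A C = C A` maps into `P ∩ Q = 0`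
      have hAC : ∀ u, A (C u) = 0 := fun u => by
        have h := LinearMap.congr_fun (hcomm A hA C hC𝔅) u
        rw [Module.End.mul_apply, Module.End.mul_apply] at h
        refine hPQ0 _ (hAim _) ?_
        rw [h, hC]
        exact conj_mem_piece H (hBim _)
      have hconj : conj (B w) = C (conj w) := by rw [hC, conj_conj]
      rw [hconj, formBaseChange_skew_of_mem_hodgeLieC ψ (h𝔄 hA) v (C (conj w)), hAC, map_zero, neg_zero]
    intro x hx
    rw [hS𝔄] at hx
    induction hx using Submodule.span_induction with
    | mem x hx =>
      obtain ⟨A, hA, hAP, hAim, v, rfl⟩ := hx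
      intro y hy
      rw [hS𝔅] at hy
      induction hy using Submodule.span_induction with
      | mem y hy =>
        obtain ⟨B, hB, hBP, hBim, w, rfl⟩ := hy
        exact hgen A hA hAP hAim B hB hBP hBim v w
      | zero => rw [map_zero, map_zero]
      | add y y' _ _ hy hy' => rw [map_add, map_add, hy, hy', add_zero]
      | smul c y _ hy => rw [conj_smul, map_smul, hy, smul_zero]
    | zero => intro y _; rw [map_zero, LinearMap.zero_apply]
    | add x x' _ _ hx hx' => intro y hy; rw [map_add, LinearMap.add_apply, hx y hy, hx' y hy, add_zero]
    | smul c x _ hx => intro y hy; rw [map_smul, LinearMap.smul_apply, hx y hy, smul_zero]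
  -- `S𝔄 = S𝔅 = P` is absurd: `P ≠ 0` is not needed — if `P = 0` both alternatives hold trivially
  have hmemA : ∀ A ∈ 𝔄, (∀ p ∈ P, A p = 0) → (∀ v, A v ∈ P) → ∀ v, A v ∈ S𝔄 := fun A hA hAP hAim v => by
    rw [hS𝔄]; exact Submodule.subset_span ⟨A, hA, hAP, hAim, v, rfl⟩
  have hmemB : ∀ B ∈ 𝔅, (∀ p ∈ P, B p = 0) → (∀ v, B v ∈ P) → ∀ v, B v ∈ S𝔅 := fun B hB hBP hBim v => by
    rw [hS𝔅]; exact Submodule.subset_span ⟨B, hB, hBP, hBim, v, rfl⟩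
  rcases himgA with hA0 | hSAP
  · left
    intro A hA hAP hAim
    refine LinearMap.ext fun v => ?_
    have h : A v ∈ S𝔄 := hmemA A hA hAP hAim v
    rw [hA0, Submodule.mem_bot] at h
    rw [h, LinearMap.zero_apply]
  rcases himgB with hB0 | hSBP
  · right
    intro B hB hBP hBim
    refine LinearMap.ext fun v => ?_
    have h : B v ∈ S𝔅 := hmemB B hB hBP hBim v
    rw [hB0, Submodule.mem_bot] at h
    rw [h, LinearMap.zero_apply]
  -- both images are `P`: then `ψ_ℂ(p, conj p) = 0` on `P`, so `P = 0` by Hodge–Riemann, and again everything raising is `0`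
  left
  intro A hA hAP hAim
  refine LinearMap.ext fun v => ?_
  rw [LinearMap.zero_apply]
  by_contra hne
  have hp : A v ∈ P := hAim v
  obtain ⟨r, hr, hre⟩ := ψ.pos 1 0 (by norm_num) (A v) hp hne
  have h0 : ω (A v) (conj (A v)) = 0 := horth _ (by rw [hSAP]; exact hp) _ (by rw [hSBP]; exact hp)
  rw [hω] at h0
  rw [h0, mul_zero] at hre
  have hr0 : (r : ℂ) = 0 := hre.symm
  exact hr.ne' (by exact_mod_cast hr0)

/-! ## §2 No raising elements ⟹ commutes with `Θ` -/

omit [Module.Finite ℚ V] [HodgeTensorFacts.{u, u}] in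
/-- **A conjugation-stable `ad Θ`-stable subspace without non-zero raising elements commutes with `Θ`** (weight one):
`Y = Y⁺ + Y⁻ + ½(Y + ΘYΘ)` with `Y⁺ = ¼(Y + ΘY − YΘ − ΘYΘ)` raising, `Y⁻ = ¼(Y − ΘY + YΘ − ΘYΘ)` lowering — the
conjugate of a raising element of `𝔅` —, both in `𝔅`; if they vanish, `Y = ΘYΘ`, i.e. `ΘY = YΘ`.
[cite: Deligne1982HodgeCycles, I §3 (proof of Prop. 3.4: `ad μ` has weights `0, ±1`)] -/
theorem WeightOneSimple.commute_theta_of_raising_trivial (H : HodgeStructure V n) (hn : n = 1) (heff : H.IsEffective)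
    {Θ : Module.End ℂ (ℂ ⊗[ℚ] V)} (hΘ : ∀ p, ∀ x ∈ H.piece p (n - p), Θ x = ((2 * p - n : ℤ) : ℂ) • x)
    {𝔅 : Submodule ℂ (Module.End ℂ (ℂ ⊗[ℚ] V))} (had : ∀ Z ∈ 𝔅, Θ * Z - Z * Θ ∈ 𝔅)
    (h𝔅conj : ∀ B ∈ 𝔅, ∀ C : Module.End ℂ (ℂ ⊗[ℚ] V), (∀ v, C v = conj (B (conj v))) → C ∈ 𝔅)
    (h0 : ∀ B ∈ 𝔅, (∀ p ∈ H.piece 1 0, B p = 0) → (∀ v, B v ∈ H.piece 1 0) → B = 0) :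
    ∀ Y ∈ 𝔅, Θ * Y = Y * Θ := by
  subst hn
  obtain ⟨hPmem, hQmem, hΘ10, hΘ01, hΘΘ⟩ := UnitaryTheta.theta_facts H rfl heff hΘ
  have hTfix : ∀ x : ℂ ⊗[ℚ] V, Θ x = x → x ∈ H.piece 1 0 := fun x hx => by
    have h := hPmem x
    rwa [hx, ← two_smul ℂ x, smul_smul, inv_mul_cancel₀ (two_ne_zero' ℂ), one_smul] at h
  have hTneg : ∀ x : ℂ ⊗[ℚ] V, Θ x = -x → x ∈ H.piece 0 1 := fun x hx => by
    have h := hQmem x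
    rwa [hx, sub_neg_eq_add, ← two_smul ℂ x, smul_smul, inv_mul_cancel₀ (two_ne_zero' ℂ), one_smul] at h
  intro Y hY
  -- the raising component vanishes
  have hRmem := PlusLineSimple.raise_mem_of_ad_stable had hΘΘ hY
  have hRP : ∀ p ∈ H.piece 1 0, ((4 : ℂ)⁻¹ • (Y + Θ * Y - Y * Θ - Θ * Y * Θ)) p = 0 := fun p hp =>
    UnitaryTheta.raise_apply_of_eq Θ Y (hΘ10 p hp)
  have hRim : ∀ v, ((4 : ℂ)⁻¹ • (Y + Θ * Y - Y * Θ - Θ * Y * Θ)) v ∈ H.piece 1 0 := fun v =>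
    hTfix _ (UnitaryTheta.apply_raise_apply hΘΘ Y v)
  have hR0 := h0 _ hRmem hRP hRim
  -- the lowering component: the raising component for `−Θ`
  have had' : ∀ Z ∈ 𝔅, (-Θ) * Z - Z * (-Θ) ∈ 𝔅 := fun Z hZ => by
    have h : (-Θ) * Z - Z * (-Θ) = -(Θ * Z - Z * Θ) := LinearMap.ext fun v => by
      simp only [LinearMap.sub_apply, Module.End.mul_apply, LinearMap.neg_apply, map_neg]; abel
    rw [h]; exact Submodule.neg_mem _ (had Z hZ)
  have hΘΘ' : ∀ v, (-Θ) ((-Θ) v) = v := fun v => by rw [LinearMap.neg_apply, LinearMap.neg_apply, map_neg, neg_neg, hΘΘ]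
  have hLmem := PlusLineSimple.raise_mem_of_ad_stable had' hΘΘ' hY
  set L := (4 : ℂ)⁻¹ • (Y + (-Θ) * Y - Y * (-Θ) - (-Θ) * Y * (-Θ)) with hLdef
  have hLQ : ∀ q ∈ H.piece 0 1, L q = 0 := fun q hq =>
    UnitaryTheta.raise_apply_of_eq (-Θ) Y (by rw [LinearMap.neg_apply, hΘ01 q hq, neg_neg])
  have hLim : ∀ v, L v ∈ H.piece 0 1 := fun v => hTneg _ (by
    have h := UnitaryTheta.apply_raise_apply hΘΘ' Y v
    rw [LinearMap.neg_apply, neg_eq_iff_eq_neg] at h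
    exact h)
  obtain ⟨C, hC⟩ := exists_conjOp L
  have hC𝔅 : C ∈ 𝔅 := h𝔅conj L hLmem C hC
  obtain ⟨hCP, hCim, -, hconjL⟩ := SymplecticThetaTen.conjOp_raise (P := H.piece 0 1) (Q := H.piece 1 0)
    (fun x hx => conj_mem_piece H hx) (fun x hx => conj_mem_piece H hx) hLQ hLim hC
  have hC0 := h0 C hC𝔅 hCP hCim
  have hL0 : L = 0 := LinearMap.ext fun v => by
    have h := hconjL v
    rw [hC0, LinearMap.zero_apply] at h
    rw [LinearMap.zero_apply, ← conj_conj (L v), h, map_zero]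
  -- `Y = Y⁺ + Y⁻ + ½(Y + ΘYΘ)`, so `Y = ΘYΘ`
  have hΘ2 : Θ * Θ = 1 := LinearMap.ext fun v => by rw [Module.End.mul_apply, hΘΘ, Module.End.one_apply]
  have hsum : (4 : ℂ)⁻¹ • (Y + Θ * Y - Y * Θ - Θ * Y * Θ) + L = (2 : ℂ)⁻¹ • (Y - Θ * Y * Θ) := by
    have h1 : (-Θ) * Y = -(Θ * Y) := LinearMap.ext fun v => by
      simp only [Module.End.mul_apply, LinearMap.neg_apply]
    have h2 : Y * (-Θ) = -(Y * Θ) := LinearMap.ext fun v => by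
      simp only [Module.End.mul_apply, LinearMap.neg_apply, map_neg]
    have h3 : (-Θ) * Y * (-Θ) = Θ * Y * Θ := LinearMap.ext fun v => by
      simp only [Module.End.mul_apply, LinearMap.neg_apply, map_neg, neg_neg]
    rw [hLdef, h3, h1, h2]
    module
  rw [hR0, hL0, add_zero] at hsum
  have hY : Y = Θ * Y * Θ := by
    have h : (2 : ℂ)⁻¹ • (Y - Θ * Y * Θ) = 0 := hsum.symm
    rw [smul_eq_zero] at h
    rcases h with h | h
    · exact absurd h (inv_ne_zero (two_ne_zero' ℂ))
    · exact sub_eq_zero.1 h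
  calc Θ * Y = Θ * (Θ * Y * Θ) := by rw [← hY]
    _ = (Θ * Θ) * Y * Θ := by noncomm_ring
    _ = Y * Θ := by rw [hΘ2, one_mul]

/-! ## §3 `End_Hdg = ℚ` ⟹ `Lie Hg` is `ℚ`-simple -/

set_option maxHeartbeats 800000 in
/-- **For an effective polarized weight-one Hodge structure on `V ≠ 0` with `End_Hdg(V) = ℚ`, `Lie Hg(H)` is a SIMPLE Lie
algebra over `ℚ`**: every Lie subalgebra `𝔏 ≤ 𝔤𝔩_ℚ(V)` with carrier `Lie Hg(H)` satisfies `LieAlgebra.IsSimple ℚ 𝔏`.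
`𝔷 = 0` gives `𝔥 = [𝔥, 𝔥]` semisimple (Deligne I 3.6); for an ideal `I` with complement `J` (`[I, J] = 0`, `I ⊕ J = 𝔥`) the
orthogonality lemma (§1, `𝔄 = I_ℂ`, `𝔅 = J_ℂ`) leaves one of them without raising elements, hence commuting with `Θ` (§2),
hence inside `𝔥 ∩ End_Hdg = 0` (`mem_endAlg_of_commute_theta`).  The tree's `isSimple_hodgeLie_of_plusLine_of_forall_endAlg_eq_smul`
is the special case of the plus-line position. [cite: Deligne1982HodgeCycles, I §3 Prop. 3.4, Prop. 3.6 and Example 3.7]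
[cite: MoonenZarhin1999LowDim, §2 (2.3) and §3 (3.1)] [cite: Humphreys1972, §5.2] -/
theorem isSimple_hodgeLie_of_forall_endAlg_eq_smul [Nontrivial V] (H : HodgeStructure V n) (ψ : H.Polarization)
    (hn : n = 1) (heff : H.IsEffective) (hE : ∀ a ∈ H.endAlg, ∃ x : ℚ, a = x • 1) :
    letI : LieRing (Module.End ℚ V) := LieRing.ofAssociativeRing
    ∀ 𝔏 : LieSubalgebra ℚ (Module.End ℚ V), 𝔏.toSubmodule = H.hodgeLie → LieAlgebra.IsSimple ℚ 𝔏 := by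
  letI : LieRing (Module.End ℚ V) := LieRing.ofAssociativeRing
  intro 𝔏 h𝔏
  classical
  obtain ⟨Θ, hΘ⟩ := exists_hodgeTheta H
  have hz := hodgeLie_inf_endAlg_eq_bot_of_forall_endAlg_eq_smul H ψ hE
  have hmain := fun (𝔄 𝔅 : Submodule ℂ (Module.End ℂ (ℂ ⊗[ℚ] V))) =>
    WeightOneSimple.raising_trivial_of_commute H ψ hn heff hE hΘ (𝔄 := 𝔄) (𝔅 := 𝔅)
  have hcommΘ := fun (𝔅 : Submodule ℂ (Module.End ℂ (ℂ ⊗[ℚ] V))) =>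
    WeightOneSimple.commute_theta_of_raising_trivial H hn heff hΘ (𝔅 := 𝔅)
  subst hn
  obtain ⟨hPmem, hQmem, hΘ10, hΘ01, hΘΘ⟩ := UnitaryTheta.theta_facts H rfl heff hΘ
  have hΘM : Θ ∈ H.hodgeLieC := H.mem_hodgeLieC_of_forall_piece hΘ
  -- `𝔷 = 0`: the derived algebra is everything, so `𝔏` is semisimple
  set 𝔡 := Submodule.span ℚ {B | ∃ X ∈ H.hodgeLie, ∃ Y ∈ H.hodgeLie, X * Y - Y * X = B} with h𝔡def
  have h𝔡 : 𝔡 = H.hodgeLie := by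
    have h := AnyWeight.hodgeLie_center_sup_derived_eq H ψ
    rwa [hz, bot_sup_eq] at h
  haveI hss : LieAlgebra.IsSemisimple ℚ 𝔏 :=
    AnyWeight.isSemisimple_of_eq_hodgeLie_derived H ψ 𝔏 (h𝔏.trans h𝔡.symm)
  have hmem𝔏 : ∀ {x : Module.End ℚ V}, x ∈ 𝔏 ↔ x ∈ H.hodgeLie := fun {x} => by
    rw [← LieSubalgebra.mem_toSubmodule, h𝔏]
  -- the rational subspace of `End V` underlying an ideal of `𝔏`
  let ι : LieIdeal ℚ 𝔏 → Submodule ℚ (Module.End ℚ V) := fun I =>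
    { carrier := {x | ∃ y : 𝔏, y ∈ I ∧ (y : Module.End ℚ V) = x}
      zero_mem' := ⟨0, I.zero_mem, rfl⟩
      add_mem' := by
        rintro _ _ ⟨y, hy, rfl⟩ ⟨y', hy', rfl⟩
        exact ⟨y + y', add_mem hy hy', rfl⟩
      smul_mem' := by
        rintro c _ ⟨y, hy, rfl⟩
        exact ⟨c • y, (I : Submodule ℚ 𝔏).smul_mem c hy, rfl⟩ }
  have hι : ∀ (I : LieIdeal ℚ 𝔏) (x : Module.End ℚ V), x ∈ ι I ↔ ∃ y : 𝔏, y ∈ I ∧ (y : Module.End ℚ V) = x :=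
    fun I x => Iff.rfl
  have hιle : ∀ I : LieIdeal ℚ 𝔏, ι I ≤ H.hodgeLie := by
    rintro I _ ⟨y, -, rfl⟩
    exact hmem𝔏.1 y.2
  have hιid : ∀ I : LieIdeal ℚ 𝔏, ∀ X ∈ H.hodgeLie, ∀ A ∈ ι I, X * A - A * X ∈ ι I := by
    rintro I X hX _ ⟨y, hy, rfl⟩
    refine ⟨⁅(⟨X, hmem𝔏.2 hX⟩ : 𝔏), y⁆, I.lie_mem hy, ?_⟩
    rw [LieSubalgebra.coe_bracket, Ring.lie_def]
  have hιC : ∀ I : LieIdeal ℚ 𝔏, spanC (ι I) ≤ H.hodgeLieC := fun I => by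
    rw [hodgeLieC_eq_spanC]
    exact spanC_mono (hιle I)
  have had : ∀ I : LieIdeal ℚ 𝔏, ∀ Z ∈ H.hodgeLieC, ∀ A ∈ spanC (ι I), Z * A - A * Z ∈ spanC (ι I) :=
    fun I Z hZ A hA => bracket_mem_spanC_of_ideal (hιid I) (by rw [← hodgeLieC_eq_spanC]; exact hZ) hA
  have hconjC : ∀ I : LieIdeal ℚ 𝔏, ∀ B ∈ spanC (ι I), ∀ C : Module.End ℂ (ℂ ⊗[ℚ] V),
      (∀ v, C v = conj (B (conj v))) → C ∈ spanC (ι I) := fun I B hB C hC => conjOp_mem_spanC hB hC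
  -- an ideal whose complex span has no raising element is `⊥`
  have key : ∀ I : LieIdeal ℚ 𝔏,
      (∀ B ∈ spanC (ι I), (∀ p ∈ H.piece 1 0, B p = 0) → (∀ v, B v ∈ H.piece 1 0) → B = 0) → I = ⊥ := by
    intro I h0
    have hcomm := hcommΘ (spanC (ι I)) (fun Z hZ => had I Θ hΘM Z hZ) (hconjC I) h0
    rw [eq_bot_iff]
    intro y hy
    have hyι : (y : Module.End ℚ V) ∈ ι I := ⟨y, hy, rfl⟩
    have hyE : (y : Module.End ℚ V) ∈ H.endAlg :=
      mem_endAlg_of_commute_theta H hΘ (hcomm _ (baseChange_mem_spanC hyι)).symm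
    have hy0 : (y : Module.End ℚ V) ∈ H.hodgeLie ⊓ Subalgebra.toSubmodule H.endAlg :=
      Submodule.mem_inf.2 ⟨hmem𝔏.1 y.2, hyE⟩
    rw [hz, Submodule.mem_bot] at hy0
    rw [LieSubmodule.mem_bot]
    exact Subtype.ext hy0
  refine ⟨fun I => ?_, fun hab => ?_⟩
  · -- every ideal is `⊥` or `⊤`
    set J : LieIdeal ℚ 𝔏 := Iᶜ with hJ
    have hIJ : I ⊓ J = ⊥ := inf_compl_eq_bot
    have hIJ' : I ⊔ J = ⊤ := sup_compl_eq_top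
    -- `[I_ℂ, J_ℂ] = 0`
    have hcommIJ : ∀ A ∈ spanC (ι I), ∀ B ∈ spanC (ι J), A * B = B * A := by
      have hgen : ∀ X ∈ ι I, ∀ Y ∈ ι J, X * Y = Y * X := by
        rintro _ ⟨x, hx, rfl⟩ _ ⟨y, hy, rfl⟩
        have h : ⁅x, y⁆ ∈ I ⊓ J := LieSubmodule.lie_le_inf I J (LieSubmodule.lie_coe_mem_lie ⟨x, hx⟩ ⟨y, hy⟩)
        rw [hIJ, LieSubmodule.mem_bot] at h
        have h' := congrArg (fun w : 𝔏 => (w : Module.End ℚ V)) h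
        simp only [LieSubalgebra.coe_bracket, Ring.lie_def, ZeroMemClass.coe_zero] at h'
        exact sub_eq_zero.1 h'
      intro A hA
      induction hA using Submodule.span_induction with
      | mem A hA =>
        obtain ⟨X, hX, rfl⟩ := hA
        intro B hB
        induction hB using Submodule.span_induction with
        | mem B hB =>
          obtain ⟨Y, hY, rfl⟩ := hB
          rw [← LinearMap.baseChange_mul, ← LinearMap.baseChange_mul, hgen X hX Y hY]
        | zero => rw [mul_zero, zero_mul]
        | add B B' _ _ hB hB' => rw [mul_add, add_mul, hB, hB']
        | smul c B _ hB => rw [mul_smul_comm, smul_mul_assoc, hB]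
      | zero => intro B _; rw [zero_mul, mul_zero]
      | add A A' _ _ hA hA' => intro B hB; rw [add_mul, mul_add, hA B hB, hA' B hB]
      | smul c A _ hA => intro B hB; rw [smul_mul_assoc, mul_smul_comm, hA B hB]
    rcases hmain (spanC (ι I)) (spanC (ι J)) (hιC I) (hιC J) (had I) (had J) (hconjC J) hcommIJ with h | h
    · exact Or.inl (key I h)
    · right
      have hJ0 := key J h
      rw [hJ0, sup_bot_eq] at hIJ'
      exact hIJ'
  · -- not abelian: `𝔥 = [𝔥, 𝔥]` would vanish, then `Θ = 0` and `V^{1,0} = 0`, `V = 0`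
    have h𝔡0 : 𝔡 ≤ ⊥ := by
      refine Submodule.span_le.2 ?_
      rintro _ ⟨X, hX, Y, hY, rfl⟩
      have h := hab.trivial (⟨X, hmem𝔏.2 hX⟩ : 𝔏) ⟨Y, hmem𝔏.2 hY⟩
      have h' := congrArg (fun w : 𝔏 => (w : Module.End ℚ V)) h
      simp only [LieSubalgebra.coe_bracket, Ring.lie_def, ZeroMemClass.coe_zero] at h'
      rw [SetLike.mem_coe, Submodule.mem_bot]
      exact h'
    have hC0 : H.hodgeLieC ≤ ⊥ := by
      refine Submodule.span_le.2 ?_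
      rintro _ ⟨X, hX, rfl⟩
      have hX' : X ∈ 𝔡 := by rw [h𝔡]; exact hX
      have hX0 : X = 0 := (Submodule.mem_bot ℚ).1 (h𝔡0 hX')
      change X.baseChange ℂ ∈ (⊥ : Submodule ℂ (Module.End ℂ (ℂ ⊗[ℚ] V)))
      rw [hX0, LinearMap.baseChange_zero]
      exact Submodule.zero_mem _
    have hΘ0 : Θ = 0 := (Submodule.mem_bot ℂ).1 (hC0 hΘM)
    -- every vector is `p + q` with `Θ p = p`, `Θ q = -q`; `Θ = 0` forces `p = q = 0`, so `V_ℂ = 0`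
    haveI : Nontrivial (ℂ ⊗[ℚ] V) := Module.nontrivial_of_finrank_pos (R := ℂ)
      (by rw [Module.finrank_baseChange]; exact Module.finrank_pos)
    obtain ⟨w, hw⟩ := exists_ne (0 : ℂ ⊗[ℚ] V)
    have hPQv : ∀ w : ℂ ⊗[ℚ] V, (2 : ℂ)⁻¹ • (w + Θ w) + (2 : ℂ)⁻¹ • (w - Θ w) = w := fun w => by module
    have hp0 : ∀ p ∈ H.piece 1 0, p = 0 := fun p hp => by rw [← hΘ10 p hp, hΘ0, LinearMap.zero_apply]
    have hq0 : ∀ q ∈ H.piece 0 1, q = 0 := fun q hq => by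
      have h := hΘ01 q hq
      rw [hΘ0, LinearMap.zero_apply] at h
      exact neg_eq_zero.1 h.symm
    apply hw
    rw [← hPQv w, hp0 _ (hPmem _), hq0 _ (hQmem _), add_zero]

end HodgeStructure

end Literature.AlgebraicGeometry.Motives
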